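import Literature.AnabelianGeometry.EtaleTheta.Discharge.Sec5Thm56EndKnitLevelN
import Literature.AnabelianGeometry.EtaleTheta.Discharge.Sec5LevelNCoefficientMap

/-!
# [EtTh] Prop. 5.5 ⊕ Thm. 5.6 (i) — the LEVEL-`N` END KNIT with the coefficient map `e`, `he`, `hPproj` and the leaf `hproj` DISCHARGED under the projection pin

Mochizuki, *The étale theta function and its Frobenioid-theoretic manifestations*, Publ. RIMS **45** (2009)
[cite: MochizukiEtTh2009, Prop 5.5 p.327 (PDF p.101); Thm 5.6 p.328–329 (PDF pp.102–103); §2 p.46].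
abc-iut cell, layer L2, row K4 «SUBDAG-Thm56» complement (seat abc-iut-w4-d042, gen 4; GO of the knit holder abc-iut-w5-d034 g5, STATUS 11:39:50Z).
PROOF-ONLY (no definitions; nothing of the producers restated).

`ThetaFrobenioid.exists_rigidityFamily_unique_preserved_ofConnectedTemperoidData_levelN_projPin` — abc-iut-w5-d034's level-`N` end knit
`…_ofConnectedTemperoidData_levelN` (`Discharge/Sec5Thm56EndKnitLevelN.lean`, p442234: `Q := RD.levelStub ιX`, `P` pinned at `B_N^bs` by
abc-iut-w4-d042's `hPpre`, any Frobenius-trivial Galois `A_⊙`) with FOUR more binders DISCHARGED, given the SECOND, cast-free pin on `P` at `B_N^bs`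

  `hPproj_pin : ∀ (σ : P.pre B_N^bs) (τ : autPre q_N ι_N (B_N^bs)), mapAut σ = τ → (P.proj B_N^bs σ : (l·Δ_Θ ⊗ ℤ/Nℤ)_{B_N^bs}) = autProj q_N ι_N (B_N^bs) τ`

(`P.proj` at `B_N^bs` IS print's `Aut`-projection read through the fully faithful inclusion — like `hPpre`, a `rfl`/`Subtype.ext` for abc-iut-L2-t4's planned
v-next term, GAP-LEDGER G-w4d042g3-1 plan (a); until then `P` stays a binder honestly):

* `e`, `he`, `hPproj` — the coefficient identification `e : μ_N → (l·Δ_Θ)_{B_N} ⊗ ℤ/Nℤ` ("`(l·Δ_Θ) ↠ (l·Δ_Θ) ⊗ ℤ/Nℤ ≅ μ_N`", p. 46) is PRODUCED inside the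
  proof from abc-iut-w4-d042's record-free `exists_coeffMap_autProj_levelN` (`Discharge/Sec5LevelNCoefficientMap.lean`, p440814: `autProj (ρ k)` depends only
  on `thetaMod k`; onto because `B_N^bs` is Galois, abc-iut-w5-d020 p438430) read on `P` through the pin;
* `hproj` — the structural leaf, from abc-iut-w4-d042's conjugation law `ThetaSubquotient.map_autProj_eq_autProj_conj` (p429126) through the two pins.

Since `e` is no longer an input, the two downstream binders that mentioned it are carried in their COEFFICIENT-FREE forms (equivalent for the produced `e`
by `hPproj` and `thetaMod_surjective`; derived inside the proof): `hme` becomes `m (ν (mk (P.proj (ρ k)))) = thetaMod k` for `k ∈ Π^tp_Ÿ ∩ (l·Δ_Θ)`, and the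
premise of `hKν` becomes `η(ρ k) = mk (P.proj (ρ k'))` whenever `thetaMod k' = η₀ k`.

RESIDUAL binders = those of p442234 MINUS {`e`, `he`, `hPproj`, `hproj`} PLUS {`hPproj_pin`}, with `hme`/`hKν` restated coefficient-free.  For the R2
carrier at level `N` the `(Q,P)`-binders {hpre, hlift/hcov', hcovHB, hgeom, e, he, hPproj, hproj, hLc, hLi} of Prop. 5.5 are now ALL theorems modulo the two
pin equations on `P` at `B_N^bs`.  The instance binder `[RD.iotaN.range.Normal]` is `RigidData.iotaN_range_normal`.
HONEST FRAMING: kernel-checked implications between typed statements; nothing asserts that such data exist for an actual curve; typed ≠ discharged for the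
remaining named binders; [EtTh] is refereed and nothing here bears on [IUTchIII] Cor. 3.12 — no side taken.
-/
noncomputable section

namespace Literature.AnabelianGeometry.EtaleTheta

open CategoryTheory Opposite FrobenioidCyclotomicRigidity Literature.AlgebraicGeometry.Frobenioids
  Literature.AnabelianGeometry.SemiGraphs Literature.AnabelianGeometry.SemiGraphs.GaloisObjects

universe u₀ v₀ w' v₁ u₁

namespace ThetaFrobenioid

section ConnectedProjPin

variable {K : Type u₀} [Field K] {X : SemiGraphs.TemperedArithmeticGroup.{u₀} K} {D₀ : Type u₀} [Category.{v₀} D₀]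
  {V : FrdIMonoidStub.{max u₀ w'}} {T₀ : RealifiedDivisorMonoids (D₀ := D₀) V}
  {VD : FrdICatStub.{u₀ + 1, u₀, max u₀ w'} (ConnectedPart (BTemp X.Pi))}
  {tf : TemperedFrobenioid T₀ (ConnectedPart (BTemp X.Pi)) VD} {hZ : tf.monoidType = MonoidType.Z}
  {hP : ∀ A : (ConnectedPart (BTemp X.Pi))ᵒᵖ, IsPerfect (tf.Φ.carrier A)}
  {NH : Subgroup (Field.absoluteGaloisGroup K) → tf.category → ℕ+ → Prop} {A₀ : tf.category}
  {hA₀ : PreFrobenioid.IsFrobeniusTrivial tf.toElem A₀} {hA₀' : SemiGraphs.IsGaloisObj A₀.base.obj}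
  {lv N : ℕ+} {l' : ℕ} {RD : RigidData.{max u₀ w'} N l'}
  {pullFrac : ∀ {A A' : (BiKummerSetting.mkOfConnectedTemperoid X tf hZ hP NH A₀ hA₀ hA₀').C} (_ : A' ⟶ A),
    (BiKummerSetting.mkOfConnectedTemperoid X tf hZ hP NH A₀ hA₀ hA₀').biratUnits A →
      (BiKummerSetting.mkOfConnectedTemperoid X tf hZ hP NH A₀ hA₀ hA₀').biratUnits A'}
  {θ : (BiKummerSetting.mkOfConnectedTemperoid X tf hZ hP NH A₀ hA₀ hA₀').biratUnits
    (BiKummerSetting.mkOfConnectedTemperoid X tf hZ hP NH A₀ hA₀ hA₀').Aodot}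
  {Bl : (BiKummerSetting.mkOfConnectedTemperoid X tf hZ hP NH A₀ hA₀ hA₀').C}
  {Pl : (BiKummerSetting.mkOfConnectedTemperoid X tf hZ hP NH A₀ hA₀ hA₀').FractionPair θ Bl}
  {Rl : (BiKummerSetting.mkOfConnectedTemperoid X tf hZ hP NH A₀ hA₀ hA₀').NthRoot θ Pl lv pullFrac}
  (h : ModelFrobenioid.Hypotheses tf.divisorMonoid tf.ratFnFunctor)
  (odd_l : Odd (lv : ℕ))
  (R : (BiKummerSetting.mkOfConnectedTemperoid X tf hZ hP NH A₀ hA₀ hA₀').NthRoot Rl.root Rl.pair N pullFrac)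
  (ιX : RD.PiX ≃ₜ* X.Pi) (K' : Type (max u₀ w')) [Field K'] (constEmb : K'ˣ →* tf.biratUnitsModel R.BN)
  (constEmb_injective : Function.Injective constEmb)
  (hinvc : ∀ g : Aut R.AN.base,
    pull tf.divisorMonoid g.hom (ModelFrobenioid.div R.pair.num) = ModelFrobenioid.div R.pair.num)
  (hinvp : ∀ y : RD.PiX, y ∈ RD.PiYdd →
    pull tf.divisorMonoid ((BiKummerSetting.mkOfConnectedTemperoid X tf hZ hP NH A₀ hA₀ hA₀').galoisSurj R.AN.base
      R.αData.isGalois (ιX y)).hom (ModelFrobenioid.div R.pair.den) = ModelFrobenioid.div R.pair.den)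
  [RD.iotaN.range.Normal]

/-- **The record-free coefficient map read in the data's currency** `(l·Δ_Θ)_{B_N} ⊗ ℤ/Nℤ = 𝔉.lDeltaModN 𝔉.BN` (one definitional conversion of
abc-iut-w4-d042's `exists_coeffMap_autProj_levelN`, p440814; any Frobenius-trivial Galois `A_⊙`): a SURJECTIVE `e : μ_N → (l·Δ_Θ)_{B_N} ⊗ ℤ/Nℤ` with
`mk (autProj (ρ k)) = e (thetaMod k)` on `(l·Δ_Θ)`.  [cite: MochizukiEtTh2009, Prop 5.5 p.327 (PDF p.101); §2 p.46] -/
theorem exists_coeffMap_levelStub_of_pins :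
    ∃ e : RD.mu → (ofConnectedTemperoidData h (RD.levelStub ιX) odd_l R ιX K' constEmb constEmb_injective hinvc hinvp).lDeltaModN (ofConnectedTemperoidData h (RD.levelStub ιX) odd_l R ιX K' constEmb constEmb_injective hinvc hinvp).BN, Function.Surjective e ∧
      ∀ (k : RD.PiX) (hk : k ∈ RD.lDeltaTheta)
        (hm : ((Functor.mapAut R.BN.base (connectedObjects (BTemp X.Pi)).ι).comp (rhoOfBiKummerData R ιX)) k ∈ ThetaSubquotient.autPre (RD.qN ιX) RD.iotaN R.BN.base.obj),
        (QuotientGroup.mk (ThetaSubquotient.autProj (RD.qN ιX) RD.iotaN R.BN.base.obj ⟨_, hm⟩) : (ofConnectedTemperoidData h (RD.levelStub ιX) odd_l R ιX K' constEmb constEmb_injective hinvc hinvp).lDeltaModN (ofConnectedTemperoidData h (RD.levelStub ιX) odd_l R ιX K' constEmb constEmb_injective hinvc hinvp).BN) =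
          e (RD.thetaMod ⟨k, hk⟩) := by
  obtain ⟨e₀, he₀, hPe₀⟩ := exists_coeffMap_autProj_levelN.{u₀, v₀, max u₀ w'} (hZ := hZ) (hP := hP) (NH := NH) R ιX
  exact ⟨e₀, he₀, fun k hk hm => hPe₀ k hk hm⟩

/-- **`hproj` under the two pins, `B_N^bs`-spelled, any Frobenius-trivial Galois `A_⊙`** (the §5-choice instance is abc-iut-w4-d042's
`hproj_levelN_of_pin_base`, p442340): abc-iut-w4-d042's conjugation law `ThetaSubquotient.map_autProj_eq_autProj_conj` (p429126) read through the `rfl`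
dictionary and the pins.  [cite: MochizukiEtTh2009, Prop 5.5 p.327–328 (PDF pp.101–102)] -/
theorem hproj_levelStub_of_pins (P : ThetaSubquotientProj (ofConnectedTemperoidData h (RD.levelStub ιX) odd_l R ιX K' constEmb constEmb_injective hinvc hinvp))
  (hPpre : P.pre R.BN.base =
    (ThetaSubquotient.autPre (RD.qN ιX) RD.iotaN R.BN.base.obj).comap (Functor.mapAut R.BN.base (connectedObjects (BTemp X.Pi)).ι))
  (hPproj_pin : ∀ (σ : P.pre R.BN.base) (τ : ThetaSubquotient.autPre (RD.qN ιX) RD.iotaN R.BN.base.obj),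
    Functor.mapAut R.BN.base (connectedObjects (BTemp X.Pi)).ι (σ : Aut R.BN.base) = (τ : Aut R.BN.base.obj) →
      (P.proj R.BN.base σ : ThetaSubquotient.LDelta (RD.qN ιX) RD.iotaN R.BN.base.obj) =
        ThetaSubquotient.autProj (RD.qN ιX) RD.iotaN R.BN.base.obj τ)
    (g g' : Aut R.BN.base) (hh : g' ∈ P.pre R.BN.base) :
    ∃ hgh : g * g' * g⁻¹ ∈ P.pre R.BN.base,
      (ofConnectedTemperoidData h (RD.levelStub ιX) odd_l R ιX K' constEmb constEmb_injective hinvc hinvp).lDeltaMap g.hom (P.proj R.BN.base ⟨g', hh⟩) = P.proj R.BN.base ⟨g * g' * g⁻¹, hgh⟩ := by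
  have hh' : Functor.mapAut R.BN.base (connectedObjects (BTemp X.Pi)).ι g' ∈ ThetaSubquotient.autPre (RD.qN ιX) RD.iotaN R.BN.base.obj := by
    rw [hPpre] at hh
    exact hh
  have hconj : Functor.mapAut R.BN.base (connectedObjects (BTemp X.Pi)).ι g * Functor.mapAut R.BN.base (connectedObjects (BTemp X.Pi)).ι g' * (Functor.mapAut R.BN.base (connectedObjects (BTemp X.Pi)).ι g)⁻¹ = Functor.mapAut R.BN.base (connectedObjects (BTemp X.Pi)).ι (g * g' * g⁻¹) := by
    rw [map_mul, map_mul, map_inv]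
  have hgh' : Functor.mapAut R.BN.base (connectedObjects (BTemp X.Pi)).ι (g * g' * g⁻¹) ∈ ThetaSubquotient.autPre (RD.qN ιX) RD.iotaN R.BN.base.obj := by
    rw [← hconj]
    exact ThetaSubquotient.conj_mem_autPre (RD.qN ιX) RD.iotaN R.BN.base.obj _ hh'
  have hgh : g * g' * g⁻¹ ∈ P.pre R.BN.base := by
    rw [hPpre]
    exact hgh'
  refine ⟨hgh, ?_⟩
  have h1 := hPproj_pin ⟨g', hh⟩ ⟨_, hh'⟩ rfl
  have h2 := hPproj_pin ⟨g * g' * g⁻¹, hgh⟩ ⟨_, hgh'⟩ rfl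
  have h3 := ThetaSubquotient.map_autProj_eq_autProj_conj (RD.qN ιX) RD.iotaN R.BN.base.property (Functor.mapAut R.BN.base (connectedObjects (BTemp X.Pi)).ι g) ⟨_, hh'⟩
  change ThetaSubquotient.map (RD.qN ιX) RD.iotaN R.BN.base.property R.BN.base.property (Functor.mapAut R.BN.base (connectedObjects (BTemp X.Pi)).ι g).hom
      (P.proj R.BN.base ⟨g', hh⟩ : ThetaSubquotient.LDelta (RD.qN ιX) RD.iotaN R.BN.base.obj) =
    (P.proj R.BN.base ⟨g * g' * g⁻¹, hgh⟩ : ThetaSubquotient.LDelta (RD.qN ιX) RD.iotaN R.BN.base.obj)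
  rw [h1, h2]
  exact h3.trans (congrArg _ (Subtype.ext hconj))

/-- **K4 END KNIT AT LEVEL `N` WITH THE COEFFICIENT MAP AND `hproj` DISCHARGED** ([EtTh] Prop. 5.5 ⊕ Thm. 5.6 (i) at abc-iut-L2-t4's
`ofConnectedTemperoidData` with `Q := levelStub`, any Frobenius-trivial Galois `A_⊙`, `P` pinned at `B_N^bs` by `hPpre` AND `hPproj_pin`): abc-iut-w5-d034's
`…_levelN` with `e`/`he`/`hPproj` PRODUCED (p440814) and `hproj` PROVED (p429126).  [cite: MochizukiEtTh2009, Thm 5.6 p.328–329 (PDF pp.102–103)] -/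
theorem exists_rigidityFamily_unique_preserved_ofConnectedTemperoidData_levelN_projPin
    -- Prop 5.5 side (η / ν pin, reachability, stub laws)
    (hB : (ofConnectedTemperoidData h (RD.levelStub ιX) odd_l R ιX K' constEmb constEmb_injective hinvc hinvp).IsThetaSaturated (ofConnectedTemperoidData h (RD.levelStub ιX) odd_l R ιX K' constEmb constEmb_injective hinvc hinvp).BN) (P : ThetaSubquotientProj (ofConnectedTemperoidData h (RD.levelStub ιX) odd_l R ιX K' constEmb constEmb_injective hinvc hinvp))
    -- the ONE pin: `P` at `B_N^bs` is print's `Aut`-subquotient domain `autPre q_N ι_N` read through `Aut_D(B_N^bs) ↪ Aut(B_N^bs.obj)`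
    -- (abc-iut-w4-d042's `hPpre`; DUAL CLAUSE G-w4d042g3-1: no `P`-TERM until v-next `proj_surjective_of_isGaloisObj`)
    (hPpre : P.pre R.BN.base =
      (ThetaSubquotient.autPre (RD.qN ιX) RD.iotaN R.BN.base.obj).comap (Functor.mapAut R.BN.base (connectedObjects (BTemp X.Pi)).ι))
    -- the SECOND pin (abc-iut-w4-d042): `P.proj` at `B_N^bs` IS print's `autProj` read through `Aut_D(B_N^bs) ↪ Aut(B_N^bs.obj)` (cast-free form)
    (hPproj_pin : ∀ (σ : P.pre R.BN.base) (τ : ThetaSubquotient.autPre (RD.qN ιX) RD.iotaN R.BN.base.obj),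
      Functor.mapAut R.BN.base (connectedObjects (BTemp X.Pi)).ι (σ : Aut R.BN.base) = (τ : Aut R.BN.base.obj) →
        (P.proj R.BN.base σ : ThetaSubquotient.LDelta (RD.qN ιX) RD.iotaN R.BN.base.obj) =
          ThetaSubquotient.autProj (RD.qN ιX) RD.iotaN R.BN.base.obj τ)
    {η₀ : RD.PiYdd → RD.mu} (hη₀ : η₀ ∈ RD.thetaCocycles)
    (hdies : ∀ k : RD.PiYdd, rhoOfBiKummerData R ιX k = 1 → η₀ k = 1)
    (ν : (ofConnectedTemperoidData h (RD.levelStub ιX) odd_l R ιX K' constEmb constEmb_injective hinvc hinvp).lDeltaModN (ofConnectedTemperoidData h (RD.levelStub ιX) odd_l R ιX K' constEmb constEmb_injective hinvc hinvp).BN ≃* (ofConnectedTemperoidData h (RD.levelStub ιX) odd_l R ιX K' constEmb constEmb_injective hinvc hinvp).muTorsion (ofConnectedTemperoidData h (RD.levelStub ιX) odd_l R ιX K' constEmb constEmb_injective hinvc hinvp).BN (ofConnectedTemperoidData h (RD.levelStub ιX) odd_l R ιX K' constEmb constEmb_injective hinvc hinvp).N)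
    -- hKν with the coefficient map ELIMINATED (abc-iut-w4-d042): «η ∘ ρ = e ∘ η₀» reads «η(ρ k) = mk (P.proj (ρ k'))» whenever `thetaMod k' = η₀ k`
    (hKν : ∀ η : (ofConnectedTemperoidData h (RD.levelStub ιX) odd_l R ιX K' constEmb constEmb_injective hinvc hinvp).HB → (ofConnectedTemperoidData h (RD.levelStub ιX) odd_l R ιX K' constEmb constEmb_injective hinvc hinvp).lDeltaModN (ofConnectedTemperoidData h (RD.levelStub ιX) odd_l R ιX K' constEmb constEmb_injective hinvc hinvp).BN,
      (∀ (k k' : RD.PiYdd) (hk' : (k' : RD.PiX) ∈ RD.lDeltaTheta) (hm' : rhoOfBiKummerData R ιX k' ∈ P.pre _),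
          RD.thetaMod ⟨k', hk'⟩ = η₀ k →
            η ⟨rhoOfBiKummerData R ιX k, Subgroup.mem_map_of_mem _ k.2⟩ =
              (QuotientGroup.mk (P.proj _ ⟨rhoOfBiKummerData R ιX k', hm'⟩) : (ofConnectedTemperoidData h (RD.levelStub ιX) odd_l R ιX K' constEmb constEmb_injective hinvc hinvp).lDeltaModN (ofConnectedTemperoidData h (RD.levelStub ιX) odd_l R ιX K' constEmb constEmb_injective hinvc hinvp).BN)) →
        FrobenioidThetaBiKummer.ThetaPairKummerClass (ofConnectedTemperoidData h (RD.levelStub ιX) odd_l R ιX K' constEmb constEmb_injective hinvc hinvp) η ν)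
    -- T56-L09b: Prop 3.4 (ii) constants + the origin clause «cnst kills Ker aug» (G-w5d020-2)
    {Dcnst : Type u₁} [Category.{v₁} Dcnst] {cnst : D₀ ⥤ Dcnst} (hP34 : RealifiedDivisorMonoids.Prop34Cnst T₀ cnst)
    (hΔcnst : ∀ δ ∈ RD.aug.ker,
      cnst.map (tf.base.map (rhoOfBiKummerData R ιX δ).hom) = 𝟙 (cnst.obj (tf.base.obj R.BN.base)))
    (hreach : LinearlyReachableFromBN (ofConnectedTemperoidData h (RD.levelStub ιX) odd_l R ιX K' constEmb constEmb_injective hinvc hinvp))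
    -- hKR (G-L6t23-3) by abc-iut-w4-d099's PIN route (p-file Sec5ThetaSectionCompatOfKummerClass): «Prop 5.2 (iii) enters ONCE» —
    -- the (η₀, ν) pin above + Facts + the cyclotome dictionary m with m ∘ ν ∘ e = id + cyclotomic-character compatibility (F-1306)
    (H : (ofConnectedTemperoidData h (RD.levelStub ιX) odd_l R ιX K' constEmb constEmb_injective hinvc hinvp).Facts)
    (m : (ofConnectedTemperoidData h (RD.levelStub ιX) odd_l R ιX K' constEmb constEmb_injective hinvc hinvp).muTorsion (ofConnectedTemperoidData h (RD.levelStub ιX) odd_l R ιX K' constEmb constEmb_injective hinvc hinvp).BN (ofConnectedTemperoidData h (RD.levelStub ιX) odd_l R ιX K' constEmb constEmb_injective hinvc hinvp).N ≃* RD.mu)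
    -- hme with the coefficient map ELIMINATED (abc-iut-w4-d042): `m ∘ ν ∘ e = id` reads `m (ν (mk (P.proj (ρ k)))) = thetaMod k` on `Π^tp_Ÿ ∩ (l·Δ_Θ)`
    (hme : ∀ (k : RD.PiYdd) (hk : (k : RD.PiX) ∈ RD.lDeltaTheta) (hm : rhoOfBiKummerData R ιX k ∈ P.pre _),
      m (ν (QuotientGroup.mk (P.proj _ ⟨rhoOfBiKummerData R ιX k, hm⟩) : (ofConnectedTemperoidData h (RD.levelStub ιX) odd_l R ιX K' constEmb constEmb_injective hinvc hinvp).lDeltaModN (ofConnectedTemperoidData h (RD.levelStub ιX) odd_l R ιX K' constEmb constEmb_injective hinvc hinvp).BN)) = RD.thetaMod ⟨k, hk⟩)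
    (hχX : (ofConnectedTemperoidData h (RD.levelStub ιX) odd_l R ιX K' constEmb constEmb_injective hinvc hinvp).CyclotomicCharacterCompatX RD.toThetaEnvData (MulEquiv.refl _) m)
    -- hdiff reduced to Π^tp_Ÿ ⊆ H_⊙ (`hfrac`, `haut` are THEOREMS here: [FrdI] Thm 5.2 (ii) dictionary, abc-iut-L2-t9/t4)
    (hH : ∀ y : RD.PiX, y ∈ RD.PiYdd → ιX y ∈ (BiKummerSetting.mkOfConnectedTemperoid X tf hZ hP NH A₀ hA₀ hA₀').Hodot)
    -- Thm 5.6 side: Ψ, its base shadow, Δ-transport and μ-pull data (abc-iut-L2-d4)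
    (Ψ : (BiKummerSetting.mkOfConnectedTemperoid X tf hZ hP NH A₀ hA₀ hA₀').C ≌ (BiKummerSetting.mkOfConnectedTemperoid X tf hZ hP NH A₀ hA₀ hA₀').C) (Ψbs : ConnectedPart (BTemp X.Pi) ⥤ ConnectedPart (BTemp X.Pi)) [Ψbs.IsEquivalence] (eΨ : Ψ.functor ⋙ (ofConnectedTemperoidData h (RD.levelStub ιX) odd_l R ιX K' constEmb constEmb_injective hinvc hinvp).base ≅ (ofConnectedTemperoidData h (RD.levelStub ιX) odd_l R ιX K' constEmb constEmb_injective hinvc hinvp).base ⋙ Ψbs)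
    (aΨ : ∀ A : (BiKummerSetting.mkOfConnectedTemperoid X tf hZ hP NH A₀ hA₀ hA₀').C, (ofConnectedTemperoidData h (RD.levelStub ιX) odd_l R ιX K' constEmb constEmb_injective hinvc hinvp).lDeltaModN A ≃* (ofConnectedTemperoidData h (RD.levelStub ιX) odd_l R ιX K' constEmb constEmb_injective hinvc hinvp).lDeltaModN (Ψ.functor.obj A))
    (hlin : PreFrobenioidData.PreservesMor Ψ.functor (ofConnectedTemperoidData h (RD.levelStub ιX) odd_l R ιX K' constEmb constEmb_injective hinvc hinvp).IsLinear (ofConnectedTemperoidData h (RD.levelStub ιX) odd_l R ιX K' constEmb constEmb_injective hinvc hinvp).IsLinear)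
    (haΨn : ∀ {A A' : (BiKummerSetting.mkOfConnectedTemperoid X tf hZ hP NH A₀ hA₀ hA₀').C} (φ : A ⟶ A') (x : (ofConnectedTemperoidData h (RD.levelStub ιX) odd_l R ιX K' constEmb constEmb_injective hinvc hinvp).lDeltaModN A),
      aΨ A' ((ofConnectedTemperoidData h (RD.levelStub ιX) odd_l R ιX K' constEmb constEmb_injective hinvc hinvp).lDeltaModNMap φ x) = (ofConnectedTemperoidData h (RD.levelStub ιX) odd_l R ιX K' constEmb constEmb_injective hinvc hinvp).lDeltaModNMap (Ψ.functor.map φ) (aΨ A x))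
    (hpull : ∀ {A A' : (BiKummerSetting.mkOfConnectedTemperoid X tf hZ hP NH A₀ hA₀ hA₀').C} (φ : A ⟶ A') (u : (ofConnectedTemperoidData h (RD.levelStub ιX) odd_l R ιX K' constEmb constEmb_injective hinvc hinvp).muTorsion A' (ofConnectedTemperoidData h (RD.levelStub ιX) odd_l R ιX K' constEmb constEmb_injective hinvc hinvp).N)
      (hu : Ψ.functor.mapAut A' (u : Aut A') ∈ (ofConnectedTemperoidData h (RD.levelStub ιX) odd_l R ιX K' constEmb constEmb_injective hinvc hinvp).muTorsion (Ψ.functor.obj A') (ofConnectedTemperoidData h (RD.levelStub ιX) odd_l R ιX K' constEmb constEmb_injective hinvc hinvp).N),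
      Ψ.functor.mapAut A ((ofConnectedTemperoidData h (RD.levelStub ιX) odd_l R ιX K' constEmb constEmb_injective hinvc hinvp).muTorsionPull φ (ofConnectedTemperoidData h (RD.levelStub ιX) odd_l R ιX K' constEmb constEmb_injective hinvc hinvp).N u : Aut A) = ((ofConnectedTemperoidData h (RD.levelStub ιX) odd_l R ιX K' constEmb constEmb_injective hinvc hinvp).muTorsionPull (Ψ.functor.map φ) (ofConnectedTemperoidData h (RD.levelStub ιX) odd_l R ιX K' constEmb constEmb_injective hinvc hinvp).N ⟨_, hu⟩ : Aut (Ψ.functor.obj A)))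
    -- the NORMALISED Thm 5.7 transport (D_c = 1, e = 1: abc-iut-L2-d4 T1 + abc-iut-w5-d245 `capCupTransport_normalise`)
    (α : Ψ.functor.obj (ofConnectedTemperoidData h (RD.levelStub ιX) odd_l R ιX K' constEmb constEmb_injective hinvc hinvp).AN ≅ (ofConnectedTemperoidData h (RD.levelStub ιX) odd_l R ιX K' constEmb constEmb_injective hinvc hinvp).AN) (β : Ψ.functor.obj (ofConnectedTemperoidData h (RD.levelStub ιX) odd_l R ιX K' constEmb constEmb_injective hinvc hinvp).BN ≅ (ofConnectedTemperoidData h (RD.levelStub ιX) odd_l R ιX K' constEmb constEmb_injective hinvc hinvp).BN) {Dp₀ : Aut (ofConnectedTemperoidData h (RD.levelStub ιX) odd_l R ιX K' constEmb constEmb_injective hinvc hinvp).BN}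
    (hc₁ : α.inv ≫ Ψ.functor.map (ofConnectedTemperoidData h (RD.levelStub ιX) odd_l R ιX K' constEmb constEmb_injective hinvc hinvp).sCap ≫ β.hom = (ofConnectedTemperoidData h (RD.levelStub ιX) odd_l R ιX K' constEmb constEmb_injective hinvc hinvp).sCap)
    (hp₁ : α.inv ≫ Ψ.functor.map (ofConnectedTemperoidData h (RD.levelStub ιX) odd_l R ιX K' constEmb constEmb_injective hinvc hinvp).sCup ≫ β.hom = (ofConnectedTemperoidData h (RD.levelStub ιX) odd_l R ιX K' constEmb constEmb_injective hinvc hinvp).sCup ≫ Dp₀.hom) (hDp₀ : Dp₀ ∈ (ofConnectedTemperoidData h (RD.levelStub ιX) odd_l R ιX K' constEmb constEmb_injective hinvc hinvp).units (ofConnectedTemperoidData h (RD.levelStub ιX) odd_l R ιX K' constEmb constEmb_injective hinvc hinvp).BN)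
    -- [FrdI] Prop 5.6 / Thm 3.4 (iii) data at A_N (abc-iut-w5-d245's Prop 5.6 unit)
    -- the MODEL HYPOTHESES of [FrdI] Thm 3.4 (iii)/(v) at the §4 tempered Frobenioid ([EtTh] Thm 3.7 (i)(ii))
    (hD : IsOfFSMType (ConnectedPart (BTemp X.Pi))) (hslim : IsSlim (ConnectedPart (BTemp X.Pi))) (hnd : IsNonDilatingOn tf.divisorMonoid)
    (hN : ∃ A : (BiKummerSetting.mkOfConnectedTemperoid X tf hZ hP NH A₀ hA₀ hA₀').C, ¬ (PreFrobenioidData.ofModel tf.divisorMonoid tf.ratFnFunctor tf.divBNatTrans).IsGroupLikeObj A)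
    -- [EtTh] Cor 2.18 (i): the theta-related subquotients Π^tp_Ÿ, (l·Δ_Θ), … of Π^tp_X are CHARACTERISTIC (abc-iut-L2-t2's
    -- `RigidData.Cor218_i`, F-0620; discharged at the model data by abc-iut-L2-t8/L6) — supplies hP24/hγL for EVERY γ
    (h218i : RD.Cor218_i)
    -- T56-L09c in its γ-FREE typed form (abc-iut-w5-d020's `Thm56Sub.DeltaTransportCompat`): at B_N the Δ-transport (aΨ, β)
    -- agrees on P.pre with the map induced by the B_N-transport θ′ of every admissible base shadow θA (no γ mentioned)
    (hΔ : ∀ θA : Aut R.AN.base ≃* Aut R.AN.base,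
      (∀ f : Aut R.AN, (PreFrobenioid.baseFunctor (BiKummerSetting.mkOfConnectedTemperoid X tf hZ hP NH A₀ hA₀ hA₀').F).mapIso (α.symm ≪≫ Ψ.functor.mapIso f ≪≫ α) =
        θA ((PreFrobenioid.baseFunctor (BiKummerSetting.mkOfConnectedTemperoid X tf hZ hP NH A₀ hA₀ hA₀').F).mapIso f)) →
      Thm56Sub.DeltaTransportCompat (ofConnectedTemperoidData h (RD.levelStub ιX) odd_l R ιX K' constEmb constEmb_injective hinvc hinvp) Ψ β aΨ (((ofConnectedTemperoidData h (RD.levelStub ιX) odd_l R ιX K' constEmb constEmb_injective hinvc hinvp).autBaseIsoAB.symm.trans θA).trans (ofConnectedTemperoidData h (RD.levelStub ιX) odd_l R ιX K' constEmb constEmb_injective hinvc hinvp).autBaseIsoAB) P) :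
    ∃ ρ : RigidityFamily (ofConnectedTemperoidData h (RD.levelStub ιX) odd_l R ιX K' constEmb constEmb_injective hinvc hinvp), IsKummerDetermined (ofConnectedTemperoidData h (RD.levelStub ιX) odd_l R ιX K' constEmb constEmb_injective hinvc hinvp) P ρ hB ∧ IsFunctorialLinear (ofConnectedTemperoidData h (RD.levelStub ιX) odd_l R ιX K' constEmb constEmb_injective hinvc hinvp) ρ ∧
      (∀ ρ' : RigidityFamily (ofConnectedTemperoidData h (RD.levelStub ιX) odd_l R ιX K' constEmb constEmb_injective hinvc hinvp), IsKummerDetermined (ofConnectedTemperoidData h (RD.levelStub ιX) odd_l R ιX K' constEmb constEmb_injective hinvc hinvp) P ρ' hB → IsFunctorialLinear (ofConnectedTemperoidData h (RD.levelStub ιX) odd_l R ιX K' constEmb constEmb_injective hinvc hinvp) ρ' → ρ' = ρ) ∧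
      CyclotomicRigidityPreserved (ofConnectedTemperoidData h (RD.levelStub ιX) odd_l R ιX K' constEmb constEmb_injective hinvc hinvp) Ψ ρ aΨ := by
  -- (e, he, hPproj) from the record-free coefficient map (p440814) through the projection pin
  have hcoeff := exists_coeffMap_levelStub_of_pins.{u₀, v₀, w'} h odd_l R ιX K' constEmb constEmb_injective hinvc hinvp
  obtain ⟨e, he, hPe⟩ := hcoeff
  have hpre : ∀ k : RD.PiYdd, (k : RD.PiX) ∈ RD.lDeltaTheta → rhoOfBiKummerData R ιX k ∈ P.pre R.BN.base := by
    intro k hk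
    rw [hPpre]
    exact mapAut_rho_mem_autPre_of_coe_mem_lDeltaTheta R ιX k hk
  have hPproj : ∀ (k : RD.PiYdd) (hk : (k : RD.PiX) ∈ RD.lDeltaTheta) (hm : rhoOfBiKummerData R ιX k ∈ P.pre _),
      (QuotientGroup.mk (P.proj _ ⟨rhoOfBiKummerData R ιX k, hm⟩) : (ofConnectedTemperoidData h (RD.levelStub ιX) odd_l R ιX K' constEmb constEmb_injective hinvc hinvp).lDeltaModN (ofConnectedTemperoidData h (RD.levelStub ιX) odd_l R ιX K' constEmb constEmb_injective hinvc hinvp).BN) = e (RD.thetaMod ⟨k, hk⟩) := by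
    intro k hk hm
    have hm' : ((Functor.mapAut R.BN.base (connectedObjects (BTemp X.Pi)).ι).comp (rhoOfBiKummerData R ιX)) k ∈ ThetaSubquotient.autPre (RD.qN ιX) RD.iotaN R.BN.base.obj :=
      mapAut_rho_mem_autPre_of_coe_mem_lDeltaTheta R ιX k hk
    have hpin := hPproj_pin ⟨rhoOfBiKummerData R ιX k, hm⟩ ⟨_, hm'⟩ rfl
    exact (congrArg QuotientGroup.mk hpin).trans (hPe k hk hm')
  have hproj : ∀ (g g' : Aut ((ofConnectedTemperoidData h (RD.levelStub ιX) odd_l R ιX K' constEmb constEmb_injective hinvc hinvp).base.obj (ofConnectedTemperoidData h (RD.levelStub ιX) odd_l R ιX K' constEmb constEmb_injective hinvc hinvp).BN)) (hh : g' ∈ P.pre _), ∃ hgh : g * g' * g⁻¹ ∈ P.pre _,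
      (ofConnectedTemperoidData h (RD.levelStub ιX) odd_l R ιX K' constEmb constEmb_injective hinvc hinvp).lDeltaMap g.hom (P.proj _ ⟨g', hh⟩) = P.proj _ ⟨g * g' * g⁻¹, hgh⟩ :=
    fun g g' hh => hproj_levelStub_of_pins.{u₀, v₀, w'} h odd_l R ιX K' constEmb constEmb_injective hinvc hinvp P hPpre hPproj_pin g g' hh
  -- hme for e, from its coefficient-free form
  have hme_e : ∀ x : RD.mu, m (ν (e x)) = x := by
    intro x
    obtain ⟨g, hg⟩ := RD.thetaMod_surjective x
    have hk : (g : RD.PiX) ∈ RD.lDeltaTheta := g.2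
    have hkY : (g : RD.PiX) ∈ RD.PiYdd := (RD.lDeltaTheta_le hk).1
    have h1 := hPproj ⟨(g : RD.PiX), hkY⟩ hk (hpre ⟨(g : RD.PiX), hkY⟩ hk)
    have h2 := hme ⟨(g : RD.PiX), hkY⟩ hk (hpre ⟨(g : RD.PiX), hkY⟩ hk)
    rw [h1] at h2
    rw [← hg]
    exact h2
  -- hKν for e, from its coefficient-free form
  have hKν_e : ∀ η : (ofConnectedTemperoidData h (RD.levelStub ιX) odd_l R ιX K' constEmb constEmb_injective hinvc hinvp).HB → (ofConnectedTemperoidData h (RD.levelStub ιX) odd_l R ιX K' constEmb constEmb_injective hinvc hinvp).lDeltaModN (ofConnectedTemperoidData h (RD.levelStub ιX) odd_l R ιX K' constEmb constEmb_injective hinvc hinvp).BN,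
      (∀ k : RD.PiYdd, η ⟨rhoOfBiKummerData R ιX k, Subgroup.mem_map_of_mem _ k.2⟩ = e (η₀ k)) →
        FrobenioidThetaBiKummer.ThetaPairKummerClass (ofConnectedTemperoidData h (RD.levelStub ιX) odd_l R ιX K' constEmb constEmb_injective hinvc hinvp) η ν := by
    intro η hη
    refine hKν η (fun k k' hk' hm' hθ => ?_)
    rw [hη k, ← hθ, hPproj k' hk' hm']
  exact exists_rigidityFamily_unique_preserved_ofConnectedTemperoidData_levelN.{u₀, v₀, w', v₁, u₁} h odd_l R ιX K' constEmb
    constEmb_injective hinvc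
    hinvp hB P hPpre hη₀ hdies e he hPproj ν hKν_e hP34 hΔcnst hreach hproj H m hme_e hχX hH Ψ Ψbs eΨ aΨ hlin haΨn hpull α β hc₁
    hp₁ hDp₀ hD hslim hnd hN h218i hΔ

end ConnectedProjPin

end ThetaFrobenioid

end Literature.AnabelianGeometry.EtaleTheta

end
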